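import Summits.QuantumFields.YangMills.Theorems.UnitScaleTiltFluctuationComparisonRegPrLevelCauchyMinT
import Summits.QuantumFields.YangMills.Theorems.UnitScaleTiltFluctuationComparisonRegPrPolymerBudget
import Literature.MathematicalPhysics.QuantumFieldTheory.Balaban1983to89.T3Thresholds
import Literature.MathematicalPhysics.QuantumFieldTheory.Balaban1983to89.T3ThresholdSmallness
import HarnessLib

/-!
# Crux-ideate sketch g10 (ideator 1, TRANSFER lens; stmt-QuantumFields-19201 / live twin stmt-QuantumFields-19935) — card 9 addendum F-idea1-g10-1
# «THE GLOBAL TARGET WITH KING'S SLACK, AND ITS DIRECT CONSUMER»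

Context.  OWNER RULING ym3-torus-plan g20-№7 §8 (2026-08-27T09:18Z): STUB 3‴ `stub_pintDecompTwoRunMinFam` stays as registered (v5j′ rev 2, 15c9339353bfc2e7) and
its (C)-content is served as ONE inequality per `(K, n)`: sibling ideator 2's `GlobalSupRateT (dataOfV3 p π_blk) b₀ p₀ a C_G` (Sketch_ideator2_g9 §TopSink) —
«any `a > 0`; the consumer needs only the window Cauchy rate».  This file records, rc 0 · 0 sorry, what the TRANSFER lens says about that target:

(1) `GlobalSupRateT` quantifies the PURE relative rate `C·θ(n)²·|𝕋_n|·L^{−a(K−n)}` over ALL heights `n ≤ K`.  At a FIXED height (e.g. `n = 0`, the unit lattice)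
    the budget tends to `0` as `K → ∞` (`pure_rate_eventually_lt`), so it asserts the `V`-UNIFORM continuum-limit rate of the whole small-field effective
    interaction at that height.  No FINITE-ORDER expansion reaches this: a finite-order method leaves the two runs' order-`σ` remainders unmatched — a
    `K`-independent `V`-dependent error `~ θ(n)^σ|𝕋_n|`.  The printed abelian theorem the schema cites is itself NOT slack-free: [King1986] Thm 3.4 (3.9) p.656 bounds the two-cut-off
    difference by `c(L^{−γk}(L^kε)^{−β} + (L^kε)^{σ})|T|` — a RATE term plus an ADDITIVE SLACK `(L^kε)^σ|T|` (Taylor orders `> n̄`, (3.48)/(3.52); large fields),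
    used only where both go to zero ((3.12)–(3.13) p.657: the free fraction).  In the T³ dictionary (`L^kε ↦ L^{−n}`, `|T| ↦ |𝕋_n| = 8L^{3(m_F+n)}`,
    `θ(n)² ≍ γL^{−n}·polylog`) King's bound is EXACTLY the slack form `GlobalSupRateTSlack` below; the pure form drops King's second term.
(2) `GlobalSupRateTSlack D b₀ p₀ a σ C`: `|PintH (K+1) n V − PintH K n V − c K n| ≤ C·|𝕋_n|·(θ(n)²·L^{−a(K−n)} + θ(n)^σ)` for all `n ≤ K` — the faithful port, and
    the statement a finite-order (order `σ`) two-run Taylor/cluster comparison delivers at EVERY height (matched height-free kernels up to order `σ−1` at rate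
    `L^{−a(K−n)}` = card 9 row K1a; remainder = printed (57)); `slack_of_pure`: it is WEAKER than the served target, so nothing is lost by proving the pure form.
(3) THE DIRECT CONSUMER (pure counting, no `π`/`PT`/`PintDecompTrivT`/`TwoRunMinT` detour): `cauchyAtHeights_of_globalSupRateTSlack` — for `1 < L`, `0 < γ ≤ 1`,
    `0 < b₀`, `0 < p₀`, `0 < a`, `m > (3+a)/a` and a geometric profile `θ(n) ≤ C_θ ρⁿ` with `ρ^σ·L³ < 1`, the slack form gives S-E″'s output
    `CauchyAtHeights D b₀ p₀ m` (radii `A·(L^{−(a−(3+a)/m)})^K + B·(q^{1/m})^K`, `q = max(ρ^σL³, ½)`).  Profiles: the tree's `θ ≤ C√g` (`ρ = L^{−1/4}`) needs `σ ≥ 13`;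
    the sharp `θ ≤ C_c g^{1−c}` (`gp_le_const_mul_rpow`, any `0 < c`, from `B10.rpow_mul_exp_neg_le`; here `c = 1/8`, `ρ = L^{−7/16}`) needs only `σ ≥ 7` = print's
    «overall power greater than six» ([Balaban1985UV3] (57) p.270).  Registered-shape slots: `levelCauchyOfGlobalSupRateTSlack_dec` (σ ≥ 7) and, as a corollary with
    `σ := 13`, `levelCauchyOfGlobalSupRateT_dec` for the PURE target — i.e. the owner's served inequality closes S-E″ DIRECTLY, and so does its finite-order weakening.
(4) WINDOW-ONLY pure rate (W2) does not rescue finite order under the registered quantifier order: in 3‴ `∃ a` precedes the consumer's `∀ m ≥ m₀(a)`, and at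
    `n = ⌊K/m⌋` the slack/rate ratio is `θ(n)^{σ−2}·L^{a(m−1)n} ≳ L^{n(a(m−1)−(σ−2)/2)} → ∞` once `m > 1 + (σ−2)/(2a)` (`θ ≥ b₀g`); only an `m`-dependent
    `a = a(m) ∈ (3/(m−1), (σ−2)(1−c)/(2(m−1))]` (non-empty iff `σ ≥ 9`) would do,
    which the registered shape forbids.  Hence the recommendation of the card-9 addendum: serve `GlobalSupRateTSlack … a 7 C` (W1) as the finite-order-reachable
    (C)-content, keep `GlobalSupRateT` as the stronger all-order target (cards 6/8 engines; card 9 K1c).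

Nothing here is asserted about the Bałaban data: every `def` is a hypothesis schema, every `theorem` is arithmetic / bookkeeping over them.  `GlobalSupRateT` is
sibling ideator 2's definition (Sketch_ideator2_g9.lean §TopSink, item stmt-QuantumFields-19201 evidence), restated verbatim because crux workfiles are not importable.

References: C. King, CMP 102 (1986) 649–677 [King1986] (Thm 3.4 (3.9) p.656, (3.12)–(3.13) p.657, Prop. 3.6 (3.56) p.662, Prop. 3.9 (3.73)–(3.75) p.665);
T. Bałaban, CMP 102 (1985) 255–275 [Balaban1985UV3] ((7) p.257, (43)–(46) pp.266–267, (57) p.270).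
-/

noncomputable section

open MeasureTheory Filter Topology
open Literature.MathematicalPhysics.QuantumFieldTheory.Balaban1983to89
open Literature.MathematicalPhysics.QuantumFieldTheory.Balaban1983to89.T3ContinuumYM3Torus
open Literature.MathematicalPhysics.QuantumFieldTheory.Balaban1983to89.T3LevelShift
open Literature.MathematicalPhysics.QuantumFieldTheory.Balaban1983to89.T3UnitScaleTilt
open Literature.MathematicalPhysics.QuantumFieldTheory.Balaban1983to89.T3LogComparisonSocket
open Literature.MathematicalPhysics.QuantumFieldTheory.Balaban1983to89.T3AlphaInputsAC
open Literature.MathematicalPhysics.QuantumFieldTheory.Balaban1983to89.T3AlphaPolymerSocket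
open Literature.MathematicalPhysics.QuantumFieldTheory.Balaban1983to89.T3AlphaInputsACTwoRunLevel
open Summit.QuantumFields.YangMills.Theorems.LogComparisonPolymerBudget

namespace Summit.QuantumFields.YangMills.Cruxes.FluctuationComparisonRegPr.Ideate1GlobalSlack

variable {F : T3Family} {γ : ℝ}

/-! ## §1 The served global target (sibling ideator 2) and its slack form (King's (3.9) shape) -/

section Defs

variable (D : AlphaDataT3 F γ)

/-- **THE GLOBAL TWO-RUN BOUND AT RELATIVE RATE `L^{−a·k}`** (hypothesis schema, never asserted; sibling ideator 2's `Ideate2Sink.GlobalSupRateT`, VERBATIM — the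
(C)-content served for STUB 3‴ by OWNER RULING g20-№7 §8): on the `θ(n)`-window, `|PintH (K+1) n V − PintH K n V − c K n| ≤ C·θ(n)²·#Site(F.P n)·L^{−a(K−n)}` with
datum-independent shifts, for ALL `n ≤ K`. [cite: King1986, Prop. 3.9 (3.73)-(3.75) p.665] -/
def GlobalSupRateT (b₀ p₀ a C : ℝ) : Prop :=
  ∃ c : ℕ → ℕ → ℝ, ∀ (K n : ℕ), n ≤ K → ∀ V : GaugeField (F.P n) 0 (Matrix.specialUnitaryGroup (Fin 2) ℂ), PlaqSmall (θBal F.L γ b₀ p₀ n) V →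
    |D.PintH (K + 1) n V - D.PintH K n V - c K n| ≤
      C * θBal F.L γ b₀ p₀ n ^ 2 * (Fintype.card (Site (F.P n) 0) : ℝ) * (((F.L : ℝ) ^ (K - n))⁻¹) ^ a

/-- **THE GLOBAL TWO-RUN BOUND WITH KING'S ADDITIVE SLACK** (hypothesis schema, never asserted; F-idea1-g10-1): on the `θ(n)`-window,
`|PintH (K+1) n V − PintH K n V − c K n| ≤ C·#Site(F.P n)·(θ(n)²·L^{−a(K−n)} + θ(n)^σ)` for all `n ≤ K` — [King1986] Thm 3.4 (3.9) `c(L^{−γk}(L^kε)^{−β} + (L^kε)^σ)|T|`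
in the T³ dictionary; what an order-`σ` two-run Taylor comparison with matched height-free kernels delivers at every height. [cite: King1986, Thm 3.4 (3.9) p.656] -/
def GlobalSupRateTSlack (b₀ p₀ a : ℝ) (σ : ℕ) (C : ℝ) : Prop :=
  ∃ c : ℕ → ℕ → ℝ, ∀ (K n : ℕ), n ≤ K → ∀ V : GaugeField (F.P n) 0 (Matrix.specialUnitaryGroup (Fin 2) ℂ), PlaqSmall (θBal F.L γ b₀ p₀ n) V →
    |D.PintH (K + 1) n V - D.PintH K n V - c K n| ≤
      C * (Fintype.card (Site (F.P n) 0) : ℝ) * (θBal F.L γ b₀ p₀ n ^ 2 * (((F.L : ℝ) ^ (K - n))⁻¹) ^ a + θBal F.L γ b₀ p₀ n ^ σ)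

/-- **THE PURE TARGET IMPLIES THE SLACK FORM** (any `σ`; `C ≥ 0`): nothing proved for the served target is lost. [cite: King1986, Thm 3.4 (3.9) p.656] -/
theorem slack_of_pure {b₀ p₀ a C : ℝ} (hL : 1 ≤ F.L) (hγ : 0 < γ) (hγ1 : γ ≤ 1) (hb : 0 < b₀) (hC : 0 ≤ C) (σ : ℕ)
    (h : GlobalSupRateT D b₀ p₀ a C) : GlobalSupRateTSlack D b₀ p₀ a σ C := by
  obtain ⟨c, hc⟩ := h
  refine ⟨c, fun K n hn V hV => (hc K n hn V hV).trans ?_⟩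
  have hθ : 0 ≤ θBal F.L γ b₀ p₀ n := (T3MinimiserStabilityReduction.θBal_pos hL hγ hγ1 hb p₀ n).le
  have hslack : 0 ≤ C * (Fintype.card (Site (F.P n) 0) : ℝ) * θBal F.L γ b₀ p₀ n ^ σ := by positivity
  calc C * θBal F.L γ b₀ p₀ n ^ 2 * (Fintype.card (Site (F.P n) 0) : ℝ) * (((F.L : ℝ) ^ (K - n))⁻¹) ^ a
      = C * (Fintype.card (Site (F.P n) 0) : ℝ) * (θBal F.L γ b₀ p₀ n ^ 2 * (((F.L : ℝ) ^ (K - n))⁻¹) ^ a) := by ring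
    _ ≤ C * (Fintype.card (Site (F.P n) 0) : ℝ) * (θBal F.L γ b₀ p₀ n ^ 2 * (((F.L : ℝ) ^ (K - n))⁻¹) ^ a) +
          C * (Fintype.card (Site (F.P n) 0) : ℝ) * θBal F.L γ b₀ p₀ n ^ σ := le_add_of_nonneg_right hslack
    _ = _ := by ring

end Defs

/-! ## §2 Why the pure form at a fixed height is all-order: the budget at fixed `n` vanishes as `K → ∞` -/

/-- **THE PURE BUDGET AT A FIXED HEIGHT IS EVENTUALLY BELOW ANY FIXED ERROR**: for `1 < x`, `0 < a`, every `C` and `ε > 0` there is `K` with `C·((x^K)⁻¹)^a < ε`.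
Read at `n = 0` of `GlobalSupRateT`: a `K`-independent `V`-dependent error (the two runs' order-`σ` remainders) is incompatible with the pure rate.
[cite: King1986, (3.12)-(3.13) p.657] -/
theorem pure_rate_eventually_lt {x a : ℝ} (hx : 1 < x) (ha : 0 < a) (C : ℝ) {ε : ℝ} (hε : 0 < ε) :
    ∃ K : ℕ, C * ((x ^ K)⁻¹) ^ a < ε := by
  obtain ⟨hr0, hr1⟩ := rpow_neg_lt_one hx ha
  have hx0 : 0 < x := by linarith
  have ht : Tendsto (fun K : ℕ => C * (x ^ (-a)) ^ K) atTop (nhds (C * 0)) :=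
    (tendsto_pow_atTop_nhds_zero_of_lt_one hr0.le hr1).const_mul C
  rw [mul_zero] at ht
  obtain ⟨K, hK⟩ := (ht.eventually (gt_mem_nhds hε)).exists
  refine ⟨K, ?_⟩
  have hK' : ((x ^ K)⁻¹) ^ a = (x ^ (-a)) ^ K := by
    rw [inv_pow_rpow_eq_rpow hx0, ← Real.rpow_natCast (x ^ (-a)) K, ← Real.rpow_mul hx0.le]
    congr 1
    ring
  rwa [hK']

/-! ## §3 Profiles of the thresholds: `θ(i) ≤ C_c·g_i^{1−c}` (sharp) and the geometric forms -/

/-- **`g·p(g) ≤ b₀(p₀/c)^{p₀}e^{c−p₀}·g^{1−c}` on `(0, 1]`** (`b₀ ≥ 0`, `p₀ > 0`, any `c > 0`): `B10.rpow_mul_exp_neg_le` with a general `c` — a `c`-th of the decay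
`g = e^{−log g⁻¹}` pays for the logarithm (the tree's `T3Thresholds.gp_le_const_mul_sqrt` is `c = ½`). [cite: Balaban1985UV3, (7) p.257] -/
theorem gp_le_const_mul_rpow {b₀ p₀ c g : ℝ} (hb : 0 ≤ b₀) (hp : 0 < p₀) (hc : 0 < c) (hg : 0 < g) (hg1 : g ≤ 1) :
    g * B10.pFun b₀ p₀ g ≤ b₀ * ((p₀ / c) ^ p₀ * Real.exp (c - p₀)) * g ^ (1 - c) := by
  have hu := B10.log_inv_nonneg_of_le_one hg hg1
  set u := Real.log g⁻¹ with hu_def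
  have hcore := B10.rpow_mul_exp_neg_le p₀ c u hp hc (by linarith)
  have hg_exp : g = Real.exp (-u) := by
    rw [hu_def, Real.log_inv, neg_neg, Real.exp_log hg]
  have hgc : g ^ (1 - c) = Real.exp (-((1 - c) * u)) := by
    rw [hg_exp, ← Real.exp_mul]
    congr 1
    ring
  have hsplit : Real.exp (-u) = Real.exp (-((1 - c) * u)) * Real.exp (-(c * u)) := by
    rw [← Real.exp_add]
    congr 1
    ring
  have hK : 0 ≤ b₀ * Real.exp (-((1 - c) * u)) := mul_nonneg hb (Real.exp_pos _).le
  calc g * B10.pFun b₀ p₀ g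
      = (b₀ * Real.exp (-((1 - c) * u))) * ((1 + u) ^ p₀ * Real.exp (-(c * u))) := by
        unfold B10.pFun
        rw [← hu_def, hg_exp, hsplit]
        ring
    _ ≤ (b₀ * Real.exp (-((1 - c) * u))) * ((p₀ / c) ^ p₀ * Real.exp (c - p₀)) :=
        mul_le_mul_of_nonneg_left hcore hK
    _ = b₀ * ((p₀ / c) ^ p₀ * Real.exp (c - p₀)) * g ^ (1 - c) := by
        rw [hgc]
        ring

/-- **`θ(i) ≤ b₀(p₀/c)^{p₀}e^{c−p₀}·g_i^{1−c}`** (`L ≥ 1`, `0 < γ ≤ 1`, `b₀ ≥ 0`, `p₀ > 0`, `c > 0`). [cite: Balaban1985UV3, (7) p.257] -/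
theorem θBal_le_const_mul_coupling_rpow {L : ℕ} (hL : 1 ≤ L) {b₀ p₀ c : ℝ} (hγ : 0 < γ) (hγ1 : γ ≤ 1) (hb : 0 ≤ b₀) (hp : 0 < p₀)
    (hc : 0 < c) (i : ℕ) :
    θBal L γ b₀ p₀ i ≤ b₀ * ((p₀ / c) ^ p₀ * Real.exp (c - p₀)) * Real.sqrt (γ * ((L : ℝ)⁻¹) ^ i) ^ (1 - c) := by
  rw [T3Thresholds.θBal_eq]
  exact gp_le_const_mul_rpow hb hp hc (T3ThresholdSmallness.sqrt_coupling_pos_le hL hγ i).1 (T3Thresholds.coupling_le_one hL hγ hγ1 i)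

/-- **SHARP GEOMETRIC PROFILE**: `θ(i) ≤ (b₀(p₀/c)^{p₀}e^{c−p₀}·γ^{(1−c)/2})·((L⁻¹)^{(1−c)/2})^i`. [cite: Balaban1985UV3, (7) p.257] -/
theorem θBal_le_geometric_sharp {L : ℕ} (hL : 1 ≤ L) {b₀ p₀ c : ℝ} (hγ : 0 < γ) (hγ1 : γ ≤ 1) (hb : 0 ≤ b₀) (hp : 0 < p₀)
    (hc : 0 < c) (i : ℕ) :
    θBal L γ b₀ p₀ i ≤
      (b₀ * ((p₀ / c) ^ p₀ * Real.exp (c - p₀)) * γ ^ ((1 - c) / 2)) * (((L : ℝ)⁻¹) ^ ((1 - c) / 2)) ^ i := by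
  refine (θBal_le_const_mul_coupling_rpow hL hγ hγ1 hb hp hc i).trans (le_of_eq ?_)
  have hx0 : 0 ≤ ((L : ℝ)⁻¹) := inv_nonneg.mpr (Nat.cast_nonneg _)
  have hxi : 0 ≤ ((L : ℝ)⁻¹) ^ i := pow_nonneg hx0 i
  rw [Real.sqrt_eq_rpow, ← Real.rpow_mul (mul_nonneg hγ.le hxi), Real.mul_rpow hγ.le hxi, ← Real.rpow_natCast ((L : ℝ)⁻¹) i,
    ← Real.rpow_mul hx0, ← Real.rpow_natCast (((L : ℝ)⁻¹) ^ ((1 - c) / 2)) i, ← Real.rpow_mul hx0]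
  have e1 : (1 : ℝ) / 2 * (1 - c) = (1 - c) / 2 := by ring
  rw [e1, mul_comm (i : ℝ) ((1 - c) / 2)]
  ring

/-- **CRUDE GEOMETRIC PROFILE** (the tree's `c = ½` bound): `θ(i) ≤ (b₀(2p₀)^{p₀}e^{½−p₀}·γ^{1/4})·((L⁻¹)^{1/4})^i`. [cite: Balaban1985UV3, (7) p.257] -/
theorem θBal_le_geometric_crude {L : ℕ} (hL : 1 ≤ L) {b₀ p₀ : ℝ} (hγ : 0 < γ) (hγ1 : γ ≤ 1) (hb : 0 ≤ b₀) (hp : 0 < p₀) (i : ℕ) :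
    θBal L γ b₀ p₀ i ≤
      (b₀ * ((2 * p₀) ^ p₀ * Real.exp (1 / 2 - p₀)) * γ ^ ((1 : ℝ) / 4)) * (((L : ℝ)⁻¹) ^ ((1 : ℝ) / 4)) ^ i := by
  refine (T3Thresholds.θBal_le_const_mul_sqrt_coupling hL hγ hγ1 hb hp i).trans (le_of_eq ?_)
  have hx0 : 0 ≤ ((L : ℝ)⁻¹) := inv_nonneg.mpr (Nat.cast_nonneg _)
  have hxi : 0 ≤ ((L : ℝ)⁻¹) ^ i := pow_nonneg hx0 i
  rw [Real.sqrt_eq_rpow, Real.sqrt_eq_rpow, ← Real.rpow_mul (mul_nonneg hγ.le hxi), Real.mul_rpow hγ.le hxi,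
    ← Real.rpow_natCast ((L : ℝ)⁻¹) i, ← Real.rpow_mul hx0, ← Real.rpow_natCast (((L : ℝ)⁻¹) ^ ((1 : ℝ) / 4)) i, ← Real.rpow_mul hx0]
  have e1 : (1 : ℝ) / 2 * (1 / 2) = 1 / 4 := by ring
  rw [e1, mul_comm (i : ℝ) (1 / 4)]
  ring

/-- **THE SLACK RATIO**: `((L⁻¹)^e)^σ·L³ = L^{3 − eσ} < 1` for `1 < L` and `3 < σ·e`. [cite: King1986, (3.12)-(3.13) p.657] -/
theorem slack_ratio_lt_one {L : ℕ} (hL : 1 < L) {e : ℝ} {σ : ℕ} (h : 3 < (σ : ℝ) * e) :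
    (((L : ℝ)⁻¹) ^ e) ^ σ * (L : ℝ) ^ 3 < 1 := by
  have hLr : (1 : ℝ) < (L : ℝ) := by exact_mod_cast hL
  have hL0 : (0 : ℝ) < (L : ℝ) := by linarith
  have hrew : (((L : ℝ)⁻¹) ^ e) ^ σ * (L : ℝ) ^ 3 = (L : ℝ) ^ (-(e * σ) + 3) := by
    rw [Real.inv_rpow hL0.le, ← Real.rpow_neg hL0.le, ← Real.rpow_natCast ((L : ℝ) ^ (-e)) σ, ← Real.rpow_mul hL0.le,
      ← Real.rpow_natCast (L : ℝ) 3, ← Real.rpow_add hL0]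
    push_cast
    ring_nf
  rw [hrew]
  exact Real.rpow_lt_one_of_one_lt_of_neg hLr (by nlinarith)

/-- **`q^{⌊K/m⌋} ≤ q⁻¹·(q^{1/m})^K`** for `0 < q ≤ 1`, `0 < m` (the slack along the free fraction is geometric in `K`). [folklore] -/
theorem pow_div_le_geom {q : ℝ} (hq0 : 0 < q) (hq1 : q ≤ 1) {m : ℕ} (hm : 0 < m) (K : ℕ) :
    q ^ (K / m) ≤ q⁻¹ * (q ^ (1 / (m : ℝ))) ^ K := by
  have hm' : (0 : ℝ) < m := by exact_mod_cast hm
  have hdiv : (K : ℝ) / m - 1 ≤ ((K / m : ℕ) : ℝ) := by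
    have h := Nat.lt_div_mul_add (a := K) hm
    have h' : (K : ℝ) < ((K / m : ℕ) : ℝ) * m + m := by exact_mod_cast h
    have h'' : (K : ℝ) / m < ((K / m : ℕ) : ℝ) + 1 := by
      rw [div_lt_iff₀ hm']
      linarith
    linarith
  calc q ^ (K / m) = q ^ (((K / m : ℕ) : ℝ)) := (Real.rpow_natCast q (K / m)).symm
    _ ≤ q ^ ((K : ℝ) / m - 1) := Real.rpow_le_rpow_of_exponent_ge hq0 hq1 hdiv
    _ = q⁻¹ * (q ^ (1 / (m : ℝ))) ^ K := by
        rw [Real.rpow_sub hq0, Real.rpow_one, ← Real.rpow_natCast (q ^ (1 / (m : ℝ))) K, ← Real.rpow_mul hq0.le,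
          show 1 / (m : ℝ) * K = (K : ℝ) / m by ring]
        ring

/-! ## §4 The direct consumer: the slack form closes S-E″'s output `CauchyAtHeights` -/

section Consumer

variable (D : AlphaDataT3 F γ)

/-- **THE SOCKET FROM A WINDOW BOUND** (bookkeeping): summable `r′ ≥ 0`, shifts `c`, and the sup bound on the `θ(⌊K/m⌋)`-window give `CauchyAtHeights D b₀ p₀ m`
(the socket's a.e. and positivity guards are not needed). [cite: King1986, Thm 3.4 (3.9) p.656] -/
theorem cauchyAtHeights_of_windowBound {b₀ p₀ : ℝ} {m : ℕ} (r' c : ℕ → ℝ) (hs : Summable r') (h0 : ∀ K, 0 ≤ r' K)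
    (h : ∀ (K : ℕ) (V : GaugeField (F.P (K / m)) 0 (Matrix.specialUnitaryGroup (Fin 2) ℂ)), PlaqSmall (θBal F.L γ b₀ p₀ (K / m)) V →
      |D.PintH (K + 1) (K / m) V - D.PintH K (K / m) V - c K| ≤ r' K) :
    CauchyAtHeights D b₀ p₀ m :=
  ⟨r', c, hs, h0, fun K => ae_of_all _ fun V hV _ _ => h K V hV⟩

/-- **THE DIRECT CONSUMER OF THE SLACK FORM** (pure counting): for `1 < L`, `0 < γ ≤ 1`, `0 < b₀`, `0 < p₀`, `0 < a`, `0 ≤ C`, `m > (3+a)/a`, a geometric profile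
`θ(n) ≤ C_θρⁿ` (`ρ ≥ 0`) with `ρ^σ·L³ < 1`: `GlobalSupRateTSlack D b₀ p₀ a σ C` gives `CauchyAtHeights D b₀ p₀ m`, radii
`r′_K = C·|𝕋_{⌊K/m⌋}|·(θ(⌊K/m⌋)²L^{−a(K−⌊K/m⌋)} + θ(⌊K/m⌋)^σ) ≤ A·(L^{−(a−(3+a)/m)})^K + B·(q^{1/m})^K`, `q = max(ρ^σL³, ½)`.
[cite: King1986, Thm 3.4 (3.9) p.656 and (3.12)-(3.13) p.657] -/
theorem cauchyAtHeights_of_globalSupRateTSlack {b₀ p₀ a C Cθ ρ : ℝ} {σ m : ℕ}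
    (hL : 1 < F.L) (hγ : 0 < γ) (hγ1 : γ ≤ 1) (hb : 0 < b₀) (hp : 0 < p₀) (ha : 0 < a) (hC : 0 ≤ C)
    (hm : (3 + a) / a < (m : ℝ))
    (hρ : 0 ≤ ρ) (hθρ : ∀ n, θBal F.L γ b₀ p₀ n ≤ Cθ * ρ ^ n) (hρσ : ρ ^ σ * (F.L : ℝ) ^ 3 < 1)
    (h : GlobalSupRateTSlack D b₀ p₀ a σ C) :
    CauchyAtHeights D b₀ p₀ m := by
  classical
  obtain ⟨c, hc⟩ := h
  have hLr : (1 : ℝ) < (F.L : ℝ) := by exact_mod_cast hL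
  have hL0 : (0 : ℝ) < (F.L : ℝ) := by linarith
  have hm0r : (0 : ℝ) < m := lt_trans (by positivity) hm
  have hm0 : 0 < m := by exact_mod_cast hm0r
  have hc0 : 0 < a - (3 + a) / m := by
    have : (3 + a) / (m : ℝ) < a := by
      rw [div_lt_iff₀ hm0r]
      have := (div_lt_iff₀ ha).mp hm
      linarith
    linarith
  obtain ⟨hr0, hr1⟩ := rpow_neg_lt_one hLr hc0
  obtain ⟨Θ, hΘdef⟩ : ∃ Θ : ℝ, Θ = b₀ * ((2 * p₀) ^ p₀ * Real.exp (1 / 2 - p₀)) * Real.sqrt (Real.sqrt γ) := ⟨_, rfl⟩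
  have hθΘ : ∀ i, θBal F.L γ b₀ p₀ i ≤ Θ := fun i => by
    rw [hΘdef]; exact T3Thresholds.θBal_le_const_mul_rpow hL.le hγ hγ1 hb.le hp i
  have hθ0 : ∀ i, 0 < θBal F.L γ b₀ p₀ i := T3MinimiserStabilityReduction.θBal_pos hL.le hγ hγ1 hb p₀
  have hCθ : 0 ≤ Cθ := by
    have h := (hθ0 0).le.trans (hθρ 0)
    simpa using h
  -- the slack ratio along the free fraction
  obtain ⟨q, hqdef⟩ : ∃ q : ℝ, q = ρ ^ σ * (F.L : ℝ) ^ 3 := ⟨_, rfl⟩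
  have hq0 : 0 ≤ q := by rw [hqdef]; positivity
  obtain ⟨q₁, hq₁def⟩ : ∃ q₁ : ℝ, q₁ = max q (1 / 2) := ⟨_, rfl⟩
  have hq₁0 : 0 < q₁ := by rw [hq₁def]; exact lt_of_lt_of_le (by norm_num) (le_max_right _ _)
  have hq₁1 : q₁ < 1 := by rw [hq₁def, hqdef]; exact max_lt hρσ (by norm_num)
  have hqq₁ : q ≤ q₁ := by rw [hq₁def]; exact le_max_left _ _
  obtain ⟨r₁, hr₁def⟩ : ∃ r₁ : ℝ, r₁ = (F.L : ℝ) ^ (-(a - (3 + a) / m)) := ⟨_, rfl⟩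
  obtain ⟨r₂, hr₂def⟩ : ∃ r₂ : ℝ, r₂ = q₁ ^ (1 / (m : ℝ)) := ⟨_, rfl⟩
  have hr₂0 : 0 ≤ r₂ := by rw [hr₂def]; positivity
  have hr₂1 : r₂ < 1 := by rw [hr₂def]; exact Real.rpow_lt_one hq₁0.le hq₁1 (by positivity)
  obtain ⟨A, hAdef⟩ : ∃ A : ℝ, A = C * 8 * (F.L : ℝ) ^ (3 * F.m) * Θ ^ 2 := ⟨_, rfl⟩
  obtain ⟨B, hBdef⟩ : ∃ B : ℝ, B = C * 8 * (F.L : ℝ) ^ (3 * F.m) * Cθ ^ σ * q₁⁻¹ := ⟨_, rfl⟩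
  -- the radii
  obtain ⟨r', hr'⟩ : ∃ r' : ℕ → ℝ, ∀ K, r' K = C * (Fintype.card (Site (F.P (K / m)) 0) : ℝ) *
      (θBal F.L γ b₀ p₀ (K / m) ^ 2 * (((F.L : ℝ) ^ (K - K / m))⁻¹) ^ a + θBal F.L γ b₀ p₀ (K / m) ^ σ) := ⟨_, fun _ => rfl⟩
  have hnn : ∀ K, 0 ≤ r' K := fun K => by
    rw [hr']
    exact mul_nonneg (mul_nonneg hC (Nat.cast_nonneg _))
      (add_nonneg (mul_nonneg (pow_nonneg (hθ0 _).le 2) (Real.rpow_nonneg (inv_nonneg.mpr (pow_nonneg hL0.le _)) a))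
        (pow_nonneg (hθ0 _).le σ))
  refine cauchyAtHeights_of_windowBound D r' (fun K => c K (K / m)) ?_ hnn
    (fun K V hV => by rw [hr']; exact hc K (K / m) (Nat.div_le_self K m) V hV)
  -- summability via the majorant `A r₁^K + B r₂^K`
  have hmaj : Summable fun K : ℕ => A * r₁ ^ K + B * r₂ ^ K := by
    rw [hr₁def]
    exact ((summable_geometric_of_lt_one hr0.le hr1).mul_left A).add ((summable_geometric_of_lt_one hr₂0 hr₂1).mul_left B)
  refine hmaj.of_nonneg_of_le hnn fun K => ?_
  rw [hr', card_site_zero]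
  -- the rate term
  have h1 : C * (8 * (F.L : ℝ) ^ (3 * (F.m + K / m))) * (θBal F.L γ b₀ p₀ (K / m) ^ 2 * (((F.L : ℝ) ^ (K - K / m))⁻¹) ^ a) ≤
      A * r₁ ^ K := by
    have hθ2 : θBal F.L γ b₀ p₀ (K / m) ^ 2 ≤ Θ ^ 2 := pow_le_pow_left₀ (hθ0 _).le (hθΘ _) 2
    have hpow : (F.L : ℝ) ^ (3 * (F.m + K / m)) * (((F.L : ℝ) ^ (K - K / m))⁻¹) ^ a =
        (F.L : ℝ) ^ (3 * F.m) * (F.L : ℝ) ^ ((3 * (K / m : ℕ) - a * (K - K / m : ℕ) : ℝ)) := by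
      rw [inv_pow_rpow_eq_rpow hL0, mul_add, pow_add, ← Real.rpow_natCast (F.L : ℝ) (3 * (K / m)), mul_assoc, ← Real.rpow_add hL0]
      congr 2
      push_cast
      ring
    have hff : (F.L : ℝ) ^ ((3 * (K / m : ℕ) - a * (K - K / m : ℕ) : ℝ)) ≤ r₁ ^ K := by
      rw [hr₁def]; exact rpow_free_fraction_le hLr ha.le hm0 K
    have hXnn : 0 ≤ (F.L : ℝ) ^ ((3 * (K / m : ℕ) - a * (K - K / m : ℕ) : ℝ)) := Real.rpow_nonneg hL0.le _
    calc C * (8 * (F.L : ℝ) ^ (3 * (F.m + K / m))) * (θBal F.L γ b₀ p₀ (K / m) ^ 2 * (((F.L : ℝ) ^ (K - K / m))⁻¹) ^ a)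
        = C * 8 * θBal F.L γ b₀ p₀ (K / m) ^ 2 * ((F.L : ℝ) ^ (3 * (F.m + K / m)) * (((F.L : ℝ) ^ (K - K / m))⁻¹) ^ a) := by ring
      _ = C * 8 * θBal F.L γ b₀ p₀ (K / m) ^ 2 * ((F.L : ℝ) ^ (3 * F.m) * (F.L : ℝ) ^ ((3 * (K / m : ℕ) - a * (K - K / m : ℕ) : ℝ))) := by
          rw [hpow]
      _ ≤ C * 8 * Θ ^ 2 * ((F.L : ℝ) ^ (3 * F.m) * r₁ ^ K) :=
          mul_le_mul (mul_le_mul_of_nonneg_left hθ2 (by positivity)) (mul_le_mul_of_nonneg_left hff (by positivity))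
            (mul_nonneg (by positivity) hXnn) (by positivity)
      _ = A * r₁ ^ K := by rw [hAdef]; ring
  -- the slack term
  have h2 : C * (8 * (F.L : ℝ) ^ (3 * (F.m + K / m))) * θBal F.L γ b₀ p₀ (K / m) ^ σ ≤ B * r₂ ^ K := by
    have hθσ : θBal F.L γ b₀ p₀ (K / m) ^ σ ≤ Cθ ^ σ * (ρ ^ σ) ^ (K / m) := by
      calc θBal F.L γ b₀ p₀ (K / m) ^ σ ≤ (Cθ * ρ ^ (K / m)) ^ σ := pow_le_pow_left₀ (hθ0 _).le (hθρ _) σ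
        _ = Cθ ^ σ * (ρ ^ σ) ^ (K / m) := by rw [mul_pow, ← pow_mul, ← pow_mul, mul_comm (K / m) σ]
    have hL3 : (F.L : ℝ) ^ (3 * (F.m + K / m)) = (F.L : ℝ) ^ (3 * F.m) * ((F.L : ℝ) ^ 3) ^ (K / m) := by
      rw [← pow_mul, ← pow_add, ← mul_add]
    have hqK : (ρ ^ σ) ^ (K / m) * ((F.L : ℝ) ^ 3) ^ (K / m) = q ^ (K / m) := by rw [hqdef, mul_pow]
    have hq₁K : q ^ (K / m) ≤ q₁ ^ (K / m) := pow_le_pow_left₀ hq0 hqq₁ _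
    have hgeom : q₁ ^ (K / m) ≤ q₁⁻¹ * r₂ ^ K := by rw [hr₂def]; exact pow_div_le_geom hq₁0 hq₁1.le hm0 K
    calc C * (8 * (F.L : ℝ) ^ (3 * (F.m + K / m))) * θBal F.L γ b₀ p₀ (K / m) ^ σ
        ≤ C * (8 * (F.L : ℝ) ^ (3 * (F.m + K / m))) * (Cθ ^ σ * (ρ ^ σ) ^ (K / m)) :=
          mul_le_mul_of_nonneg_left hθσ (by positivity)
      _ = C * 8 * (F.L : ℝ) ^ (3 * F.m) * Cθ ^ σ * ((ρ ^ σ) ^ (K / m) * ((F.L : ℝ) ^ 3) ^ (K / m)) := by rw [hL3]; ring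
      _ = C * 8 * (F.L : ℝ) ^ (3 * F.m) * Cθ ^ σ * q ^ (K / m) := by rw [hqK]
      _ ≤ C * 8 * (F.L : ℝ) ^ (3 * F.m) * Cθ ^ σ * (q₁⁻¹ * r₂ ^ K) :=
          mul_le_mul_of_nonneg_left (hq₁K.trans hgeom) (by positivity)
      _ = B * r₂ ^ K := by rw [hBdef]; ring
  calc C * (8 * (F.L : ℝ) ^ (3 * (F.m + K / m))) *
        (θBal F.L γ b₀ p₀ (K / m) ^ 2 * (((F.L : ℝ) ^ (K - K / m))⁻¹) ^ a + θBal F.L γ b₀ p₀ (K / m) ^ σ)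
      = C * (8 * (F.L : ℝ) ^ (3 * (F.m + K / m))) * (θBal F.L γ b₀ p₀ (K / m) ^ 2 * (((F.L : ℝ) ^ (K - K / m))⁻¹) ^ a) +
          C * (8 * (F.L : ℝ) ^ (3 * (F.m + K / m))) * θBal F.L γ b₀ p₀ (K / m) ^ σ := by ring
    _ ≤ A * r₁ ^ K + B * r₂ ^ K := add_le_add h1 h2

/-- **THE DIRECT CONSUMER, SHARP PROFILE, `σ ≥ 7`** (print's «overall power greater than six»): for `1 < L`, `0 < γ ≤ 1`, `0 < b₀`, `0 < p₀`, `0 < a`, `0 ≤ C`,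
`m > (3+a)/a` and `7 ≤ σ`, `GlobalSupRateTSlack D b₀ p₀ a σ C` gives `CauchyAtHeights D b₀ p₀ m` (`c = 1/8`: `ρ = L^{−7/16}`, `ρ⁷L³ = L^{−1/16} < 1`).
[cite: Balaban1985UV3, (57) p.270; King1986, Thm 3.4 (3.9) p.656] -/
theorem cauchyAtHeights_of_globalSupRateTSlack_seven {b₀ p₀ a C : ℝ} {σ m : ℕ}
    (hL : 1 < F.L) (hγ : 0 < γ) (hγ1 : γ ≤ 1) (hb : 0 < b₀) (hp : 0 < p₀) (ha : 0 < a) (hC : 0 ≤ C)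
    (hm : (3 + a) / a < (m : ℝ)) (hσ : 7 ≤ σ) (h : GlobalSupRateTSlack D b₀ p₀ a σ C) :
    CauchyAtHeights D b₀ p₀ m := by
  have hc : (0 : ℝ) < 1 / 8 := by norm_num
  have hσr : (7 : ℝ) ≤ σ := by exact_mod_cast hσ
  refine cauchyAtHeights_of_globalSupRateTSlack D hL hγ hγ1 hb hp ha hC hm (ρ := ((F.L : ℝ)⁻¹) ^ ((1 - 1 / 8 : ℝ) / 2))
    (Cθ := b₀ * ((p₀ / (1 / 8)) ^ p₀ * Real.exp (1 / 8 - p₀)) * γ ^ ((1 - 1 / 8 : ℝ) / 2))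
    (by positivity) (fun n => θBal_le_geometric_sharp hL.le hγ hγ1 hb.le hp hc n) ?_ h
  exact slack_ratio_lt_one hL (by nlinarith)

/-- **THE DIRECT CONSUMER OF THE PURE (SERVED) TARGET**: for `1 < L`, `0 < γ ≤ 1`, `0 < b₀`, `0 < p₀`, `0 < a`, `0 ≤ C`, `m > (3+a)/a`, `GlobalSupRateT D b₀ p₀ a C`
gives `CauchyAtHeights D b₀ p₀ m` — the owner's served inequality closes S-E″ with NO `π`/`PT`/`PintDecompTrivT`/`TwoRunMinT` detour (`slack_of_pure` at `σ = 7`).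
[cite: King1986, Thm 3.4 (3.9) p.656 and (3.12)-(3.13) p.657] -/
theorem cauchyAtHeights_of_globalSupRateT {b₀ p₀ a C : ℝ} {m : ℕ}
    (hL : 1 < F.L) (hγ : 0 < γ) (hγ1 : γ ≤ 1) (hb : 0 < b₀) (hp : 0 < p₀) (ha : 0 < a) (hC : 0 ≤ C)
    (hm : (3 + a) / a < (m : ℝ)) (h : GlobalSupRateT D b₀ p₀ a C) :
    CauchyAtHeights D b₀ p₀ m :=
  cauchyAtHeights_of_globalSupRateTSlack_seven D hL hγ hγ1 hb hp ha hC hm le_rfl (slack_of_pure D hL.le hγ hγ1 hb hC 7 h)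

end Consumer

/-! ## §5 The two registered-shape slots (package-free; drop-in for `landed_levelCauchyOfTwoRunMinT` of the v5j′ skeleton if 3‴ is re-cut to the global form) -/

/-- Threshold arithmetic: `⌈(3+a)/a⌉ + 1 ≤ m ⟹ (3+a)/a < m`. [folklore] -/
theorem lt_of_ceil_succ_le {a : ℝ} {m : ℕ} (hm : Nat.ceil ((3 + a) / a) + 1 ≤ m) : (3 + a) / a < (m : ℝ) := by
  have h1 := Nat.le_ceil ((3 + a) / a)
  have h2 : ((Nat.ceil ((3 + a) / a) + 1 : ℕ) : ℝ) ≤ m := by exact_mod_cast hm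
  push_cast at h2
  linarith

/-- **THE S-E″ SLOT OVER THE SLACK FORM, REGISTERED QUANTIFIER SHAPE** (`ε₁ = γ₁ = 1`, `m₀ = ⌈(3+a)/a⌉ + 1`; `σ ≥ 7` and `C ≥ 0` may depend on the family):
`GlobalSupRateTSlack D b₀ p₀ a σ C → CauchyAtHeights D b₀ p₀ m`. [cite: King1986, Thm 3.4 (3.9) p.656] -/
theorem levelCauchyOfGlobalSupRateTSlack_dec :
    ∀ (L : ℕ), Odd L → 1 < L → ∀ (a : ℝ), 0 < a →
      ∃ ε₁ : ℝ, 0 < ε₁ ∧ ∀ (ε₀ : ℝ), 0 < ε₀ → ε₀ ≤ ε₁ → ∃ m₀ : ℕ, ∀ (m : ℕ), m₀ ≤ m → ∀ (b₀ p₀ : ℝ), 0 < b₀ → 2 < p₀ →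
        ∃ γ₁ : ℝ, 0 < γ₁ ∧ ∀ (F : T3Family) (γ : ℝ), F.L = L → 0 < γ → γ ≤ γ₁ →
          ∀ (D : AlphaDataT3 F γ) (σ : ℕ) (C : ℝ), 7 ≤ σ → 0 ≤ C → GlobalSupRateTSlack D b₀ p₀ a σ C → CauchyAtHeights D b₀ p₀ m := by
  intro L _ hL a ha
  refine ⟨1, one_pos, fun ε₀ _ _ => ⟨Nat.ceil ((3 + a) / a) + 1, fun m hm b₀ p₀ hb hp => ?_⟩⟩
  refine ⟨1, one_pos, fun F γ hF hγ hγ1 D σ C hσ hC h => ?_⟩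
  have hL' : 1 < F.L := by rw [hF]; exact hL
  exact cauchyAtHeights_of_globalSupRateTSlack_seven D hL' hγ hγ1 hb (by linarith) ha hC (lt_of_ceil_succ_le hm) hσ h

/-- **THE S-E″ SLOT OVER THE PURE (SERVED) TARGET, REGISTERED QUANTIFIER SHAPE** (`ε₁ = γ₁ = 1`, `m₀ = ⌈(3+a)/a⌉ + 1`; `C ≥ 0` may depend on the family):
`GlobalSupRateT D b₀ p₀ a C → CauchyAtHeights D b₀ p₀ m`. [cite: King1986, Thm 3.4 (3.9) p.656] -/
theorem levelCauchyOfGlobalSupRateT_dec :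
    ∀ (L : ℕ), Odd L → 1 < L → ∀ (a : ℝ), 0 < a →
      ∃ ε₁ : ℝ, 0 < ε₁ ∧ ∀ (ε₀ : ℝ), 0 < ε₀ → ε₀ ≤ ε₁ → ∃ m₀ : ℕ, ∀ (m : ℕ), m₀ ≤ m → ∀ (b₀ p₀ : ℝ), 0 < b₀ → 2 < p₀ →
        ∃ γ₁ : ℝ, 0 < γ₁ ∧ ∀ (F : T3Family) (γ : ℝ), F.L = L → 0 < γ → γ ≤ γ₁ →
          ∀ (D : AlphaDataT3 F γ) (C : ℝ), 0 ≤ C → GlobalSupRateT D b₀ p₀ a C → CauchyAtHeights D b₀ p₀ m := by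
  intro L _ hL a ha
  refine ⟨1, one_pos, fun ε₀ _ _ => ⟨Nat.ceil ((3 + a) / a) + 1, fun m hm b₀ p₀ hb hp => ?_⟩⟩
  refine ⟨1, one_pos, fun F γ hF hγ hγ1 D C hC h => ?_⟩
  have hL' : 1 < F.L := by rw [hF]; exact hL
  exact cauchyAtHeights_of_globalSupRateT D hL' hγ hγ1 hb (by linarith) ha hC (lt_of_ceil_succ_le hm) h

end Summit.QuantumFields.YangMills.Cruxes.FluctuationComparisonRegPr.Ideate1GlobalSlack

end
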